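import Literature.NumberTheory.Automorphic.GJUnfoldingData
import Literature.NumberTheory.Automorphic.CompactGroupKFiniteVectors
import Literature.NumberTheory.Automorphic.SatakeParameterTrivialBound
import Literature.NumberTheory.Automorphic.GLnCuspidalSpectrumSiegel
import Literature.NumberTheory.Automorphic.GodementJacquetPartialL
import Mathlib.MeasureTheory.Measure.Haar.Unique
import Mathlib.Analysis.Complex.CauchyIntegral
import Literature.NumberTheory.Automorphic.GodementJacquetSingularDefectVanishing
import Literature.NumberTheory.Automorphic.GodementJacquetAssembly
import Literature.NumberTheory.Automorphic.GodementJacquetZetaOperator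
import Literature.NumberTheory.Automorphic.GLnCuspFormsOrthogonalConstants
import Literature.NumberTheory.Automorphic.SmoothedCuspFormGeneric
import Literature.NumberTheory.Automorphic.GLnCuspidalSiegelDecay
import Literature.NumberTheory.Automorphic.GodementJacquetGlobalHolomorphy

/-!
# Godement–Jacquet's Euler factorisation of the global zeta integral: discharge of
`GodementJacquet1972_gjZeta_eulerFactorisation`

Topic `NumberTheory/Automorphic`; namespace `Literature.NumberTheory.Automorphic`. Sibling proof file
of `GodementJacquetZetaIntegrals`: it proves, sorry-free and without new named facts,

* `GodementJacquet1972_gjZeta_eulerFactorisation_holds` : the named fact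
  `GodementJacquet1972_gjZeta_eulerFactorisation` (Godement–Jacquet, LNM 260, Thm. 13.8 (proof) with
  Thm. 3.3, Lemma 6.10, Thm. 8.7): for every cuspidal `Π`, finite `S`, honest Satake family `α` off
  `S` and Haar measure `ν` on `GL_n(𝔸_K)` there are a Schwartz–Bruhat `Φ`, non-zero `K`-finite
  `φ = φ' ∈ Π`, a meromorphic `A` of finite order somewhere and `x₀` with
  `Z(Φ, s + (n-1)/2, φ, φ') = A(s) · L^S(s, Π)` for `re s > x₀`.

The proof is the `K^T`-spherical unfolding assembled from the accepted bricks
`GJUnfoldingLocal` → `GJUnfoldingCosets` → `GJUnfoldingIntegral` → `GJUnfoldingData` (and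
`CompactGroupKFiniteVectors` for the `K`-finite spherical vector), in place of the printed route
through the restricted tensor product `Π ≅ ⊗' Π_v` and the local theory at every place:

1. `exists_isKFiniteVector_principalCongruenceLevel`: a `K`-finite `0 ≠ φ ∈ Π` fixed by some `K(𝔫₀)`.
2. `exists_unfolding_data`: a level `𝔫`, `T = T(𝔫) ⊇ S ∪ T(𝔫₀)`, a bump `Φ_∞` and a compact `N`;
   `Φ = Φ_∞ ⊗ 1_{B(𝔫)}` (`gjTestFunction_mem`), `φ' = φ`.
3. The given Haar measure is `ν = c · (dh ⊗ da)` (Mathlib `Measure.isMulLeftInvariant_eq_smul`,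
   `awayProductMeasure` of Haar measures on `H^T`, `G_T`), and `Z_{cν} = c Z_ν` (`gjZeta_smul_measure`).
4. `gjZeta_awayProductMeasure_eq`: `Z(Φ, s', φ, φ) = vol(K^T) · (∏'_{w ∉ T} localEulerInv) · Z_T(s')`,
   `s' = s + (n-1)/2`, on `re s' ≥ n² + n + 2`.
5. `localEulerInv_eq_inv_eval`: `localEulerInv n (α w) w (s + (n-1)/2) = P_w(q_w^{-s})⁻¹ = L_w(s)`
   (`#α w = n`; the bridge asked for in the review of `GJUnfoldingCosets`), and
   `partialStandardL_eq_prod_mul_tprod`: `L^S = ∏_{v ∈ T ∖ S} L_v · L^T` once `L^T` converges.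
6. `A(s) = c · vol(K^T) · Z_T(s + (n-1)/2) · ∏_{v ∈ T ∖ S} P_v(q_v^{-s})` is entire
   (`differentiable_placesZeta`, polynomials in `q_v^{-s}`), hence meromorphic, and `A(σ₀) ≠ 0` at
   `σ₀ = n² + n + 4` (`re_placesZeta_pos`; `P_v(q_v^{-σ}) ≠ 0` for `σ ≥ n² + 2` by the trivial
   Satake bound, `norm_mul_cpow_neg_lt_one` / `IsSatakeFamilyOf.norm_le`), so
   `meromorphicOrderAt A σ₀ = 0 ≠ ⊤`; and `Z = A · L^S` on `re s > n² + n + 3` since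
   `P_v · P_v⁻¹ = 1` there.

Remarks. (1) The half-plane `re s > n² + n + 3` is far from optimal (the unfolding bricks use the
trivial bounds `#Δ_m ≤ (2^n q^{n²})^m` and `|α| ≤ q^{n² + 1}`); the named fact only asks for some
half-plane. (2) `n = 0` is covered (all local factors are `1`). (3) With this discharge, the glue
`godementJacquet_hasMeromorphicContinuation_of_gjZeta_of_summable` (`GodementJacquetContinuation`)
needs only the named facts `GodementJacquet1972_gjZeta_meromorphic` (the global functional
equation / Poisson summation side, LNM 260 Thm. 13.8 with Thm. 11.2) and
`summable_normSq_trace_satakePow` (Jacquet–Shalika (1981), (5.3.3)).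

References: R. Godement, H. Jacquet, *Zeta functions of simple algebras*, LNM 260 (1972), §§3, 6,
8, 10–13; H. Jacquet, *Principal L-functions of the linear group*, Proc. Symp. Pure Math. 33.2
(1979), §6; H. Jacquet, J. Shalika, *On Euler products and the classification of automorphic
representations I*, Amer. J. Math. 103 (1981), §5.
-/

noncomputable section

open scoped MatrixGroups NNReal Topology Classical InnerProductSpace ENNReal
open NumberField NumberField.mixedEmbedding IsDedekindDomain MeasureTheory Filter Polynomial

namespace Literature.NumberTheory.Automorphic

/-! ### The local factors: `localEulerInv` versus `eulerPolynomial` -/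

section Bridge

variable {K : Type} [Field K] [NumberField K]

/-- `(√q_w)^{n-1} q_w^{-(s + (n-1)/2)} = q_w^{-s}` for `n ≥ 1`. [folklore] -/
theorem sqrt_pow_mul_cpow_neg_add (w : HeightOneSpectrum (𝓞 K)) {n : ℕ} (hn : 0 < n) (s : ℂ) :
    ((Real.sqrt (w.residueCard : ℝ) : ℝ) : ℂ) ^ (n - 1) * (w.residueCard : ℂ) ^ (-(s + ((n : ℂ) - 1) / 2)) =
      (w.residueCard : ℂ) ^ (-s) := by
  have hq : (0 : ℝ) < w.residueCard := by exact_mod_cast (zero_lt_one.trans w.one_lt_residueCard)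
  have hq0 : (w.residueCard : ℂ) ≠ 0 := by exact_mod_cast hq.ne'
  have h1 : ((Real.sqrt (w.residueCard : ℝ) : ℝ) : ℂ) ^ (n - 1) = (w.residueCard : ℂ) ^ (((n : ℂ) - 1) / 2) := by
    have e1 : ((n : ℂ) - 1) / 2 = ((((n : ℝ) - 1) / 2 : ℝ) : ℂ) := by push_cast; ring
    have e2 : (w.residueCard : ℂ) = ((w.residueCard : ℝ) : ℂ) := by norm_cast
    rw [e1, e2, ← Complex.ofReal_cpow hq.le, ← Complex.ofReal_pow]
    congr 1
    rw [Real.sqrt_eq_rpow, ← Real.rpow_natCast, ← Real.rpow_mul hq.le]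
    congr 1
    rw [Nat.cast_sub (Nat.one_le_of_lt hn)]
    push_cast
    ring
  rw [h1, ← Complex.cpow_add _ _ hq0]
  congr 1
  ring

variable {n : ℕ}

/-- **The unfolded local factor is the standard one at the shifted argument**:
`localEulerInv n α w (s + (n-1)/2) = (eulerPolynomial α (q_w^{-s}))⁻¹ = L(s, α)` for a multiset
`α` with `n` elements (for `n = 0` both sides are `1`). This is the bridge requested in the review
of `GJUnfoldingCosets`. [folklore] -/
theorem localEulerInv_eq_inv_eval {α : Multiset ℂ} (hcard : Multiset.card α = n) (w : HeightOneSpectrum (𝓞 K)) (s : ℂ) :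
    localEulerInv n α w (s + ((n : ℂ) - 1) / 2) = ((eulerPolynomial α).eval ((w.residueCard : ℂ) ^ (-s)))⁻¹ := by
  rw [localEulerInv, eval_eulerPolynomial]
  rcases Nat.eq_zero_or_pos n with hn | hn
  · subst hn
    rw [Multiset.card_eq_zero.1 hcard]
    simp
  · congr 2
    refine Multiset.map_congr rfl fun a _ => ?_
    rw [mul_comm _ a, mul_assoc, sqrt_pow_mul_cpow_neg_add w hn s]

/-- In the half-plane `re s ≥ n² + 2` the local Euler polynomials of an honest Satake family do not
vanish at `q_v^{-s}` (trivial bound `|a| ≤ q_v^{n²} + 1`, `IsSatakeFamilyOf.norm_le`). [folklore] -/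
theorem norm_mul_cpow_neg_lt_one {μ : Measure (AdelicGroupData.gl n K).automorphicQuotient}
    [(AdelicGroupData.gl n K).IsAutomorphicMeasure μ] {P : CuspidalAutomorphicRepGL n K μ}
    {S : Set (HeightOneSpectrum (𝓞 K))} {α : SatakeFamily K} (hα : IsSatakeFamilyOf P S α)
    {v : HeightOneSpectrum (𝓞 K)} (hv : v ∉ S) {a : ℂ} (ha : a ∈ α v) {s : ℂ} (hs : (n : ℝ) ^ 2 + 2 ≤ s.re) :
    ‖a * (v.residueCard : ℂ) ^ (-s)‖ < 1 := by
  have hq2 : (2 : ℝ) ≤ v.residueCard := by exact_mod_cast v.one_lt_residueCard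
  have hq : (0 : ℝ) < v.residueCard := by linarith
  have hq1 : (1 : ℝ) ≤ v.residueCard := by linarith
  rw [norm_mul, Complex.norm_natCast_cpow_of_pos (zero_lt_one.trans v.one_lt_residueCard), Complex.neg_re]
  have h1 : ‖a‖ ≤ (v.residueCard : ℝ) ^ (n ^ 2) + 1 := hα.norm_le hv ha
  have h2 : (v.residueCard : ℝ) ^ (-s.re) ≤ (v.residueCard : ℝ) ^ (-((n : ℝ) ^ 2 + 2)) :=
    Real.rpow_le_rpow_of_exponent_le hq1 (by linarith)
  have h3 : ((v.residueCard : ℝ) ^ (n ^ 2) + 1) * (v.residueCard : ℝ) ^ (-((n : ℝ) ^ 2 + 2)) ≤ 1 / 2 := by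
    rw [Real.rpow_neg hq.le, Real.rpow_add hq, Real.rpow_two, ← Real.rpow_natCast]
    push_cast
    have hX : (1 : ℝ) ≤ (v.residueCard : ℝ) ^ ((n : ℝ) ^ 2) := Real.one_le_rpow hq1 (by positivity)
    rw [add_mul, mul_inv, ← mul_assoc, mul_inv_cancel₀ (by positivity), one_mul, one_mul]
    have h4 : ((v.residueCard : ℝ) ^ 2)⁻¹ ≤ 1 / 4 := by
      rw [one_div]
      exact inv_anti₀ (by norm_num) (by nlinarith)
    have h5 : ((v.residueCard : ℝ) ^ ((n : ℝ) ^ 2))⁻¹ * ((v.residueCard : ℝ) ^ 2)⁻¹ ≤ 1 * (1 / 4) :=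
      mul_le_mul (inv_le_one_of_one_le₀ hX) h4 (by positivity) zero_le_one
    linarith
  calc ‖a‖ * (v.residueCard : ℝ) ^ (-s.re)
      ≤ ((v.residueCard : ℝ) ^ (n ^ 2) + 1) * (v.residueCard : ℝ) ^ (-((n : ℝ) ^ 2 + 2)) :=
        mul_le_mul h1 h2 (Real.rpow_nonneg hq.le _) (by positivity)
    _ ≤ 1 / 2 := h3
    _ < 1 := by norm_num

end Bridge

/-! ### Splitting the partial Euler product at a larger finite set of places -/

section Split

variable {K : Type} [Field K] [NumberField K]

/-- **`L^S = (∏_{v ∈ T ∖ S} L_v) · L^T`** for finite `S ⊆ T`, as soon as the Euler product over the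
places outside `T` converges (`HasProd.mul_compl`, `Finset.hasProd`). [folklore] -/
theorem partialStandardL_eq_prod_mul_tprod {S T : Finset (HeightOneSpectrum (𝓞 K))} (hST : S ⊆ T)
    (α : SatakeFamily K) (s : ℂ)
    (hT : Multipliable fun v : {v : HeightOneSpectrum (𝓞 K) // v ∉ T} =>
      ((eulerPolynomial (α v.1)).eval ((v.1.residueCard : ℂ) ^ (-s)))⁻¹) :
    partialStandardL (↑S : Set (HeightOneSpectrum (𝓞 K))) α s =
      (∏ v ∈ T \ S, ((eulerPolynomial (α v)).eval ((v.residueCard : ℂ) ^ (-s)))⁻¹) *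
        ∏' v : {v : HeightOneSpectrum (𝓞 K) // v ∉ T}, ((eulerPolynomial (α v.1)).eval ((v.1.residueCard : ℂ) ^ (-s)))⁻¹ := by
  set E : HeightOneSpectrum (𝓞 K) → ℂ := fun v => ((eulerPolynomial (α v)).eval ((v.residueCard : ℂ) ^ (-s)))⁻¹ with hE
  set F : HeightOneSpectrum (𝓞 K) → ℂ := ((↑S : Set (HeightOneSpectrum (𝓞 K)))ᶜ).mulIndicator E with hF
  have hFS : ∀ v, v ∈ S → F v = 1 := fun v hv =>
    Set.mulIndicator_of_notMem (show v ∉ ((↑S : Set (HeightOneSpectrum (𝓞 K)))ᶜ) from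
      fun h => (Set.mem_compl_iff _ _).1 h (Finset.mem_coe.2 hv)) E
  have hFS' : ∀ v, v ∉ S → F v = E v := fun v hv =>
    Set.mulIndicator_of_mem (show v ∈ ((↑S : Set (HeightOneSpectrum (𝓞 K)))ᶜ) from
      (Set.mem_compl_iff _ _).2 fun h => hv (Finset.mem_coe.1 h)) E
  -- `L^S = ∏' F`
  have h1 : partialStandardL (↑S : Set (HeightOneSpectrum (𝓞 K))) α s = ∏' v, F v := by
    rw [hF, ← tprod_subtype]
    rfl
  -- the product over `T` and over its complement
  have hTc : HasProd (F ∘ (↑) : ((↑T : Set (HeightOneSpectrum (𝓞 K)))ᶜ : Set (HeightOneSpectrum (𝓞 K))) → ℂ)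
      (∏' v : {v : HeightOneSpectrum (𝓞 K) // v ∉ T}, E v.1) := by
    have h2 : (F ∘ (↑) : ((↑T : Set (HeightOneSpectrum (𝓞 K)))ᶜ : Set (HeightOneSpectrum (𝓞 K))) → ℂ) =
        fun v : {v : HeightOneSpectrum (𝓞 K) // v ∉ T} => E v.1 := by
      funext v
      exact hFS' v.1 fun h => v.2 (hST h)
    rw [h2]
    exact hT.hasProd
  have hprod := (Finset.hasProd T F).mul_compl hTc
  rw [h1, hprod.tprod_eq]
  congr 1
  rw [← Finset.prod_sdiff hST, Finset.prod_congr rfl fun v hv => hFS v hv, Finset.prod_const_one, mul_one]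
  exact Finset.prod_congr rfl fun v hv => hFS' v (Finset.mem_sdiff.1 hv).2

end Split

/-! ### The Euler factorisation of the global zeta integral (discharge of G2) -/

section Main

variable {n : ℕ} {K : Type} [Field K] [NumberField K]
  {μ : Measure (AdelicGroupData.gl n K).automorphicQuotient} [(AdelicGroupData.gl n K).IsAutomorphicMeasure μ]

/-- `re (s + (n-1)/2) = re s + (n-1)/2`. [folklore] -/
theorem re_add_half_sub_one (s : ℂ) : (s + ((n : ℂ) - 1) / 2).re = s.re + ((n : ℝ) - 1) / 2 := by
  have e : ((n : ℂ) - 1) / 2 = ((((n : ℝ) - 1) / 2 : ℝ) : ℂ) := by push_cast; ring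
  rw [e, Complex.add_re, Complex.ofReal_re]

/-- The zeta integral scales with the Haar measure: `Z_{c ν} = c Z_ν`. [folklore] -/
theorem gjZeta_smul_measure [MeasurableSpace (GL (Fin n) (AdeleRing (𝓞 K) K))]
    (ν : Measure (GL (Fin n) (AdeleRing (𝓞 K) K))) (c : ℝ≥0)
    (Φ : Matrix (Fin n) (Fin n) (AdeleRing (𝓞 K) K) → ℂ) (φ φ' : (AdelicGroupData.gl n K).L2 μ) (s : ℂ) :
    gjZeta μ (c • ν) Φ φ φ' s = ((c : ℝ) : ℂ) * gjZeta μ ν Φ φ φ' s := by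
  rw [gjZeta, gjZeta, integral_smul_nnreal_measure, NNReal.smul_def, Complex.real_smul]

/-- **Godement–Jacquet's Euler factorisation with local non-vanishing holds**: discharge of the
named fact `GodementJacquet1972_gjZeta_eulerFactorisation` of `GodementJacquetZetaIntegrals`
(Godement–Jacquet, LNM 260, Thm. 13.8 (proof) with Thm. 3.3, Lemma 6.10, Thm. 8.7), by the
`K^T`-spherical unfolding: choose a non-zero `K`-finite `φ ∈ Π` fixed by some `K(𝔫₀)`
(`exists_isKFiniteVector_principalCongruenceLevel`), the data `𝔫, T = T(𝔫) ⊇ S, Φ_∞, N` of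
`exists_unfolding_data`, the test function `Φ = Φ_∞ ⊗ 1_{B(𝔫)}` (`gjTestFunction_mem`) and
`φ' = φ`; compare the given Haar measure with `dh ⊗ da` (Mathlib `Measure.isMulLeftInvariant_eq_smul`);
unfold (`gjZeta_awayProductMeasure_eq`): `Z(Φ, s', φ, φ) = c · vol(K^T) · L^T(s) · Z_T(s')`,
`s' = s + (n-1)/2` (`localEulerInv_eq_inv_eval`); write `L^S = ∏_{T∖S} L_v · L^T`
(`partialStandardL_eq_prod_mul_tprod`) and put `A(s) = c · vol(K^T) · Z_T(s') · ∏_{v ∈ T∖S} P_v(q_v^{-s})`,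
an entire function (`differentiable_placesZeta`) with `A(σ₀) ≠ 0` for real `σ₀` large
(`re_placesZeta_pos`, `norm_mul_cpow_neg_lt_one`), so that `Z = A · L^S` on `re s > n² + n + 3`.
[cite: GodementJacquet1972, Thm. 13.8 (proof) with Thm. 3.3, Lemma 6.10, Thm. 8.7] -/
theorem GodementJacquet1972_gjZeta_eulerFactorisation_holds :
    GodementJacquet1972_gjZeta_eulerFactorisation (n := n) (K := K) (μ := μ) := by
  intro P S α hα _hS _ _ ν _
  haveI : LocallyCompactSpace (GL (Fin n) (AdeleRing (𝓞 K) K)) := AdelicGroupData.locallyCompactSpace_gl_adelic_holds n K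
  haveI : SecondCountableTopology (GL (Fin n) (AdeleRing (𝓞 K) K)) :=
    secondCountableTopology_generalLinearGroup_adeleRing K (Fin n)
  -- Step 1: a non-zero `K`-finite vector of finite level
  obtain ⟨𝔫₀, φ, h𝔫₀, hφP, hφ0, hφfix, hφK⟩ := exists_isKFiniteVector_principalCongruenceLevel
    exists_fixedVectors_principalCongruenceLevel_ne_bot_holds (principalCongruenceLevel_mem_finiteLevelsGL_holds n K) P
  -- Step 2: the unfolding data
  obtain ⟨𝔫, h𝔫, Φinf, N, hST, hT₀, -, hΦ01, hΦ1, hN, hsupp⟩ := exists_unfolding_data (μ := μ) S hφ0 h𝔫₀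
  set T : Finset (HeightOneSpectrum (𝓞 K)) := primesOf h𝔫 with hTdef
  have hφT : ∀ k ∈ awayLevel K n T, (AdelicGroupData.gl n K).rightRegular μ k φ = φ := fun k hk =>
    hφfix k (awayLevel_le_principalCongruenceLevel h𝔫₀ hT₀ hk)
  have hαT : IsSatakeFamilyOf P (↑T : Set (HeightOneSpectrum (𝓞 K))) α := fun v hv =>
    hα v fun h => hv (Finset.mem_coe.2 (hST (Finset.mem_coe.1 h)))
  have hcard : ∀ v : HeightOneSpectrum (𝓞 K), v ∉ S → Multiset.card (α v) = n := by
    intro v hv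
    obtain ⟨𝔪, -, -, ϖ, hsat⟩ := hα v (fun h => hv (Finset.mem_coe.1 h))
    exact hsat.card_eq
  -- Step 3: the test function and its `G_T`-part
  set Φ := gjTestFunction n K Φinf 𝔫 with hΦdef
  set Ψ : GL (Fin n) (AdeleRing (𝓞 K) K) → ℂ := gjTestFunctionG n K Φinf 𝔫 with hΨdef
  have hΨc : Continuous Ψ := continuous_gjTestFunctionG Φinf h𝔫
  have hΨN : ∀ a : placesFactor K n T, Ψ a ≠ 0 → (a : GL (Fin n) (AdeleRing (𝓞 K) K)) ∈ N := fun a ha => (hsupp a ha).1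
  -- Step 4: Haar measures on the factors and comparison with `ν`
  letI : MeasurableSpace (awayFactor K n T) := borel _
  haveI : BorelSpace (awayFactor K n T) := ⟨rfl⟩
  letI : MeasurableSpace (placesFactor K n T) := borel _
  haveI : BorelSpace (placesFactor K n T) := ⟨rfl⟩
  haveI := locallyCompactSpace_awayFactor K n T
  haveI := locallyCompactSpace_placesFactor K n T
  set μH : Measure (awayFactor K n T) := Measure.haar with hμH
  set μG : Measure (placesFactor K n T) := Measure.haar with hμG
  set m := awayProductMeasure K n T μH μG with hm
  haveI : m.IsHaarMeasure := isHaarMeasure_awayProductMeasure μH μG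
  set c : ℝ≥0 := ν.haarScalarFactor m with hc
  have hν : ν = c • m := Measure.isMulLeftInvariant_eq_smul ν m
  have hc0 : 0 < c := Measure.haarScalarFactor_pos_of_isHaarMeasure ν m
  have hvol0 : 0 < (μH (awayLevelIn K n T)).toReal :=
    ENNReal.toReal_pos ((isOpen_awayLevelIn K n T).measure_pos μH ⟨1, one_mem _⟩).ne'
      (measure_awayLevelIn_lt_top μH).ne
  -- Step 5: the finite Euler polynomials and the function `A`
  set Pv : HeightOneSpectrum (𝓞 K) → ℂ → ℂ := fun v s => (eulerPolynomial (α v)).eval ((v.residueCard : ℂ) ^ (-s)) with hPv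
  set C : ℂ := ((c : ℝ) : ℂ) * ((μH (awayLevelIn K n T)).toReal : ℂ) with hC
  have hC0 : C ≠ 0 := mul_ne_zero (Complex.ofReal_ne_zero.2 (NNReal.coe_pos.2 hc0).ne')
    (Complex.ofReal_ne_zero.2 hvol0.ne')
  set A : ℂ → ℂ := fun s => C * placesZeta T μG Ψ φ (s + ((n : ℂ) - 1) / 2) * ∏ v ∈ T \ S, Pv v s with hA
  have hPd : ∀ v, Differentiable ℂ (Pv v) := fun v => by
    have hq0 : (v.residueCard : ℂ) ≠ 0 := by exact_mod_cast (zero_lt_one.trans v.one_lt_residueCard).ne'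
    exact (eulerPolynomial (α v)).differentiable.comp fun s => (differentiableAt_id.neg.const_cpow (Or.inl hq0))
  have hAd : Differentiable ℂ A := by
    refine ((differentiable_const C).mul ?_).mul (Differentiable.fun_finsetProd fun v _ => hPd v)
    exact (differentiable_placesZeta μG hΨc hN hΨN φ).comp (differentiable_id.add (differentiable_const _))
  -- Step 6: non-vanishing at a real point
  set σ₀ : ℝ := (n : ℝ) * n + n + 4 with hσ₀
  have hPv0 : ∀ v ∈ T \ S, ∀ s : ℂ, (n : ℝ) ^ 2 + 2 ≤ s.re → Pv v s ≠ 0 := by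
    intro v hv s hs
    exact eval_eulerPolynomial_ne_zero_of_norm_mul_lt_one fun a ha =>
      norm_mul_cpow_neg_lt_one hα (fun h => (Finset.mem_sdiff.1 hv).2 (Finset.mem_coe.1 h)) ha hs
  have hA0 : A σ₀ ≠ 0 := by
    refine mul_ne_zero (mul_ne_zero hC0 ?_) (Finset.prod_ne_zero_iff.2 fun v hv => hPv0 v hv _ ?_)
    · have e : ((σ₀ : ℝ) : ℂ) + ((n : ℂ) - 1) / 2 = (((σ₀ + ((n : ℝ) - 1) / 2 : ℝ)) : ℂ) := by push_cast; ring
      rw [e]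
      intro h0
      have hpos := re_placesZeta_pos μG hΨc (exists_gjTestFunctionG_eq hΦ01 𝔫) (gjTestFunctionG_one hΦ1 𝔫) hN hφ0 hsupp
        (σ₀ + ((n : ℝ) - 1) / 2)
      rw [h0, Complex.zero_re] at hpos
      exact lt_irrefl _ hpos
    · rw [Complex.ofReal_re, hσ₀]; nlinarith [sq_nonneg (n : ℝ), (Nat.cast_nonneg n : (0 : ℝ) ≤ n)]
  -- Step 7: the witnesses
  refine ⟨Φ, gjTestFunction_mem Φinf h𝔫, φ, hφP, φ, hφP, hφK, hφK, (n : ℝ) * n + n + 3, A,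
    fun z => (hAd.analyticAt z).meromorphicAt, ⟨σ₀, ?_⟩, fun s hs => ?_⟩
  · rw [(hAd.analyticAt _).meromorphicOrderAt_eq, (hAd.analyticAt _).analyticOrderAt_eq_zero.2 hA0]
    simp
  -- Step 8: the identity on the half-plane
  set s' : ℂ := s + ((n : ℂ) - 1) / 2 with hs'def
  have hs' : (n : ℝ) * n + n + 2 ≤ s'.re := by
    rw [hs'def, re_add_half_sub_one]
    nlinarith [(Nat.cast_nonneg n : (0 : ℝ) ≤ n)]
  have hsre : (n : ℝ) ^ 2 + 2 ≤ s.re := by nlinarith [(Nat.cast_nonneg n : (0 : ℝ) ≤ n)]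
  -- unfolding for `dh ⊗ da`
  have hmain := gjZeta_awayProductMeasure_eq μH μG P hαT hφP hφ0 hφT φ hs' Φ
    (fun a : placesFactor K n T => Ψ (a : GL (Fin n) (AdeleRing (𝓞 K) K)))
    (fun h a => gjTestFunction_mul Φinf h𝔫 h a) (continuous_gjTestFunction Φinf h𝔫)
    (integrable_norm_mul_adelicAbsDet_rpow μG hΨc hN hΨN s'.re)
  -- the Euler product over the places outside `T` at `s'` is `L^T(s)`
  have hbridge : ∀ i : {w : HeightOneSpectrum (𝓞 K) // w ∉ T}, localEulerInv n (α i.1) i.1 s' = (Pv i.1 s)⁻¹ :=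
    fun i => localEulerInv_eq_inv_eval (hcard i.1 fun h => i.2 (hST h)) i.1 s
  have hmult : Multipliable fun i : {w : HeightOneSpectrum (𝓞 K) // w ∉ T} => (Pv i.1 s)⁻¹ :=
    ((hasSum_unfoldTerm_intCosetsAway P hαT hφP hφ0 hφT φ hs').1).congr hbridge
  have hsplit := partialStandardL_eq_prod_mul_tprod hST α s hmult
  have htprod : (∏' i : {w : HeightOneSpectrum (𝓞 K) // w ∉ T}, localEulerInv n (α i.1) i.1 s') =
      ∏' i : {w : HeightOneSpectrum (𝓞 K) // w ∉ T}, (Pv i.1 s)⁻¹ := tprod_congr hbridge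
  -- cancel the finite Euler polynomials
  have hcancel : (∏ v ∈ T \ S, Pv v s) * ∏ v ∈ T \ S, (Pv v s)⁻¹ = 1 := by
    rw [← Finset.prod_mul_distrib]
    exact Finset.prod_eq_one fun v hv => mul_inv_cancel₀ (hPv0 v hv s hsre)
  -- assemble
  rw [hν, gjZeta_smul_measure, hmain.2, htprod, hsplit]
  have hAs : A s = ((c : ℝ) : ℂ) * ((μH (awayLevelIn K n T)).toReal : ℂ) * placesZeta T μG Ψ φ s' *
      ∏ v ∈ T \ S, Pv v s := rfl
  rw [hAs]
  have key : ∀ X V L Z Pp Pi : ℂ, Pp * Pi = 1 → X * (V * L * Z) = X * V * Z * Pp * (Pi * L) := by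
    intro X V L Z Pp Pi h
    linear_combination (-(X * V * Z * L)) * h
  exact key _ _ _ _ _ _ hcancel

end Main

end Literature.NumberTheory.Automorphic

/-! ## Discharge of `GodementJacquet1972_gjZeta_meromorphic` (appended) -/

namespace Literature.NumberTheory.Automorphic

open MeasureTheory Measure Set Filter Topology IsDedekindDomain NumberField
open Literature.MeasureTheory.Group
open scoped ENNReal NNReal ComplexConjugate InnerProductSpace


/-! ### Discharge of `GodementJacquet1972_gjZeta_meromorphic` -/

section MeromorphicHolds

variable {n : ℕ} {K : Type} [Field K] [NumberField K]

attribute [local instance] adelicBorel borelSpace_adelic locallyCompactSpace_adelic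
  secondCountableTopology_gl_adelic measurableSpaceQuotient borelSpaceQuotient glBorel borelSpace_glBorel
  isHaarMeasure_glForm smulInvariantMeasureQuotient isFiniteMeasureOnCompactsQuotient
  secondCountableTopology_adeleRing locallyCompactSpace_adeleRing'

/-- **The truncated zeta integral equals the dual term for smoothed cusp forms** (`n ≥ 2`,
`Re s ≥ n² + n + 2`; only `φ` needs to be a smoothed cusp form, `φ'` is any `L²` function): the
hypothesis `hvan` of `gjZeta_entire_continuation_of_eq_dual` on the dense set `smoothedCuspForms`. The reflection identity
(`gjZeta_restrict_compl_sub_dual_eq_integral_gjSingDefect`) has right-hand side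
`c ∫ β(x₀) conj φ'([x₀]) I(x₀) dν(x₀)` and `I(x₀) = 0` for every `x₀`
(`integral_bruhat_mul_singDefect_eq_zero` applied to the continuous representative
`smoothedForm η f` of `φ = R(η) f`, which is integrable with integral zero, rapidly decreasing and
cuspidal). Godement–Jacquet (1972), §12. [cite: GodementJacquetLNM260, §12] -/
theorem gjZeta_restrict_compl_eq_dual_of_smoothedCuspForms (hn : 2 ≤ n)
    (μ : Measure (AdelicGroupData.gl n K).automorphicQuotient) [(AdelicGroupData.gl n K).IsAutomorphicMeasure μ]
    (ν : Measure (AdelicGroupData.gl n K).Adelic) [ν.IsHaarMeasure]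
    [MeasurableSpace (AdeleRing (𝓞 K) K)] [BorelSpace (AdeleRing (𝓞 K) K)]
    [MeasurableSpace (Matrix (Fin n) (Fin n) (AdeleRing (𝓞 K) K))]
    [BorelSpace (Matrix (Fin n) (Fin n) (AdeleRing (𝓞 K) K))]
    (lam : Measure (Matrix (Fin n) (Fin n) (AdeleRing (𝓞 K) K))) [lam.IsAddHaarMeasure] [lam.Regular]
    {Φ : Matrix (Fin n) (Fin n) (AdeleRing (𝓞 K) K) → ℂ} (hΦ : Φ ∈ schwartzBruhatAdelicMatrix n K)
    {v : (AdelicGroupData.gl n K).L2 μ} (hv : v ∈ smoothedCuspForms n K μ) (v' : (AdelicGroupData.gl n K).L2 μ)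
    {s : ℂ} (hs : (n : ℝ) * n + n + 2 ≤ s.re) :
    gjZeta μ (ν.restrict (detAtLeastOne n K)ᶜ) Φ v v' s =
      ((lam (matrixFundamentalDomain n K)).toReal : ℂ)⁻¹ *
        ∫ g : GL (Fin n) (AdeleRing (𝓞 K) K),
          gjDualF n K (adelicMatrixFourier n K lam Φ) ((n : ℂ) - s) g⁻¹ * glMatrixCoeff μ v v' g ∂ν := by
  have hn0 : 0 < n := lt_of_lt_of_le Nat.zero_lt_two hn
  -- a Bruhat function of `H = A_G · GL_n(K)`
  obtain ⟨β, hβ⟩ := exists_isBruhatFunction (AdelicGroupData.gl n K).quotientSubgroup (quotientSubgroupHaar n K)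
    inferInstance
  -- Haar measure on `A_G`, inversion invariant (`A_G` is commutative)
  set α : Measure (AdelicGroupData.gl n K).center' := Measure.haar with hαdef
  haveI : IsMulCommutative ℝ≥0ˣ := ⟨⟨mul_comm⟩⟩
  haveI : IsMulCommutative (AdelicGroupData.gl n K).center' := Subgroup.range_isMulCommutative (posRealScalar n K)
  haveI : α.IsInvInvariant := by
    open scoped IsMulCommutative in exact IsHaarMeasure.isInvInvariant_of_regular α
  obtain ⟨κ, hκ0, hκ⟩ := exists_map_quotientSubgroupEquiv_eq_smul_prod (quotientSubgroupHaar n K) α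
  obtain ⟨cα, -, hα⟩ := exists_map_centerLog_eq_smul_volume (n := n) hn0 α
  -- the reflection identity
  have hrefl := gjZeta_restrict_compl_sub_dual_eq_integral_gjSingDefect lam μ ν hΦ v v' hs hβ hκ
  -- the inner integral vanishes for every `x₀`
  have hI : ∀ x₀ : (AdelicGroupData.gl n K).Adelic,
      ∫ y₀ : (AdelicGroupData.gl n K).Adelic, (β y₀ : ℂ) *
        ((((κ : ℝ) • ∫ a, gjSingDefect lam Φ s x₀ y₀ a ∂α)) *
          (v : (AdelicGroupData.gl n K).automorphicQuotient → ℂ) (QuotientGroup.mk y₀)) ∂ν = 0 := by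
    intro x₀
    obtain ⟨η, hη, f, rfl⟩ := hv
    set F : (AdelicGroupData.gl n K).automorphicQuotient → ℂ :=
      smoothedForm η (f : (AdelicGroupData.gl n K).L2 μ) with hFdef
    have hae : ((smoothedVector (cuspidalSubspace n K μ) η f : (AdelicGroupData.gl n K).L2 μ) :
        (AdelicGroupData.gl n K).automorphicQuotient → ℂ) =ᵐ[μ] F :=
      smoothedVector_ae_eq (cuspidalSubspace n K μ) hη.continuous hη.hasCompactSupport f
    have hc : unfoldingConstant (AdelicGroupData.gl n K).quotientSubgroup (quotientSubgroupHaar n K) μ ν ≠ 0 :=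
      (automorphicUnfoldingConstant_pos n K μ ν).ne'
    have hae' : ∀ᵐ y₀ : (AdelicGroupData.gl n K).Adelic ∂ν,
        ((smoothedVector (cuspidalSubspace n K μ) η f : (AdelicGroupData.gl n K).L2 μ) :
          (AdelicGroupData.gl n K).automorphicQuotient → ℂ) (QuotientGroup.mk y₀) = F (QuotientGroup.mk y₀) :=
      ae_comp_mk_of_ae (AdelicGroupData.gl n K).quotientSubgroup (quotientSubgroupHaar n K) μ ν hc hae
    have hFX : Continuous F := continuous_smoothedForm hη.continuous hη.hasCompactSupport _
    have hFint : Integrable F μ := (integrable_coeFn_L2 μ _).congr hae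
    have hF0 : ∫ x, F x ∂μ = 0 := by
      rw [← integral_congr_ae hae]
      exact integral_eq_zero_of_mem_cuspidalSubspace μ hn (smoothedVector (cuspidalSubspace n K μ) η f).2
    have hFd : IsRapidlyDecreasingGL n K (invQuot (AdelicGroupData.gl n K) F) :=
      isRapidlyDecreasingGL_smoothedForm_inv (μ := μ) hη f.2
    have hFcusp : ∀ k, 0 < k → k < n → CuspConditionGL n K (invQuot (AdelicGroupData.gl n K) F) k :=
      fun k hk hkn => cuspConditionGL_invQuot_smoothedForm hη.continuous hη.hasCompactSupport f.2 hk hkn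
    rw [integral_congr_ae (hae'.mono fun y₀ hy₀ => show (β y₀ : ℂ) *
        ((((κ : ℝ) • ∫ a, gjSingDefect lam Φ s x₀ y₀ a ∂α)) *
          ((smoothedVector (cuspidalSubspace n K μ) η f : (AdelicGroupData.gl n K).L2 μ) :
            (AdelicGroupData.gl n K).automorphicQuotient → ℂ) (QuotientGroup.mk y₀)) =
        (β y₀ : ℂ) * ((((κ : ℝ) • ∫ a, gjSingDefect lam Φ s x₀ y₀ a ∂α)) * F (QuotientGroup.mk y₀)) by rw [hy₀])]
    exact integral_bruhat_mul_singDefect_eq_zero lam μ ν hn0 hΦ x₀ hs hβ hκ0 hκ hα hFX hFint hF0 hFd hFcusp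
  -- hence the right-hand side of the reflection identity vanishes
  simp only [hI, mul_zero, integral_zero] at hrefl
  exact sub_eq_zero.1 hrefl

variable {μ : Measure (AdelicGroupData.gl n K).automorphicQuotient} [(AdelicGroupData.gl n K).IsAutomorphicMeasure μ] in
/-- **`GodementJacquet1972_gjZeta_meromorphic` holds.** For every cuspidal `Π ⊂ L²(GL_n(K) ℝ_{>0}\\GL_n(𝔸_K))`,
`Φ ∈ 𝒮(M_n(𝔸_K))`, `φ, φ' ∈ Π` and Haar measure `ν` (any Borel structure), `Z(Φ, s, φ, φ')`
converges absolutely on a right half-plane and agrees there with a meromorphic function on `ℂ`,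
entire for `n ≥ 2`. Cases: `n = 0` (`GodementJacquet1972_gjZeta_meromorphic_zero`), `n = 1`
(`gjZeta_meromorphic_continuation_fin_one`, Tate), `n ≥ 2`: `gjZeta_entire_continuation_of_eq_dual`
(Poisson summation and the reflection of the truncated integral), whose hypothesis — the vanishing of
the singular defect — holds on the dense set of smoothed cusp forms
(`gjZeta_restrict_compl_eq_dual_of_smoothedCuspForms`) and extends to `Π × Π ⊆ L²_cusp × L²_cusp` by
continuity of the bounded sesquilinear form `φ, φ' ↦ Z^{<1} - λ⁻¹ ∫ F'' ⟪φ', R(g)φ⟫`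
(`inner_apply_eq_zero_of_smoothedCuspForms`). Godement–Jacquet (1972), Thm. 13.8 with §11–12.
[cite: GodementJacquet1972, Thm. 13.8] -/
theorem GodementJacquet1972_gjZeta_meromorphic_holds :
    GodementJacquet1972_gjZeta_meromorphic (n := n) (K := K) (μ := μ) := by
  rcases Nat.lt_or_ge n 2 with hn | hn
  · interval_cases n
    · exact GodementJacquet1972_gjZeta_meromorphic_zero
    · intro P Φ hΦ φ φ' _ _ _ _ mG hB ν hν
      have hmG : mG = borel _ := BorelSpace.measurable_eq
      subst hmG
      obtain ⟨x₀, hint, g, hg, hgZ⟩ :=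
        @gjZeta_meromorphic_continuation_fin_one K _ _ μ _ Φ hΦ φ φ' ν hν
      exact ⟨x₀, hint, g, hg, fun h => absurd h (by norm_num), hgZ⟩
  · intro P Φ hΦ φ φ' hφ hφ' _ _ mG hB ν₀ hν₀
    have hmG : mG = borel _ := BorelSpace.measurable_eq
    subst hmG
    -- the Haar measure, read on the adelic group of the datum (house Borel structure)
    set ν : Measure (AdelicGroupData.gl n K).Adelic := ν₀ with hνdef
    haveI hν : ν.IsHaarMeasure := hν₀
    -- Borel structures on `𝔸_K` and `M_n(𝔸_K)`, and a Haar measure `λ` on `M_n(𝔸_K)`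
    letI mA : MeasurableSpace (AdeleRing (𝓞 K) K) := borel _
    haveI : BorelSpace (AdeleRing (𝓞 K) K) := ⟨rfl⟩
    letI mM : MeasurableSpace (Matrix (Fin n) (Fin n) (AdeleRing (𝓞 K) K)) := borel _
    haveI : BorelSpace (Matrix (Fin n) (Fin n) (AdeleRing (𝓞 K) K)) := ⟨rfl⟩
    haveI : LocallyCompactSpace (Matrix (Fin n) (Fin n) (AdeleRing (𝓞 K) K)) :=
      Pi.locallyCompactSpace_of_finite
    set lam : Measure (Matrix (Fin n) (Fin n) (AdeleRing (𝓞 K) K)) := Measure.addHaar with hlam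
    haveI hνinv : ν.IsInvInvariant := isInvInvariant_of_isHaarMeasure_gl n K ν
    haveI : @Measure.IsInvInvariant (GL (Fin n) (AdeleRing (𝓞 K) K)) (glBorel n K) _ ν := hνinv
    -- the vanishing of the singular defect on `Π × Π`, by density
    have hvan : ∀ s : ℂ, (n : ℝ) * n + n + 2 ≤ s.re →
        gjZeta μ (ν.restrict (detAtLeastOne n K)ᶜ) Φ φ φ' s =
          ((lam (matrixFundamentalDomain n K)).toReal : ℂ)⁻¹ *
            ∫ g : GL (Fin n) (AdeleRing (𝓞 K) K),
              gjDualF n K (adelicMatrixFourier n K lam Φ) ((n : ℂ) - s) g⁻¹ * glMatrixCoeff μ φ φ' g ∂ν := by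
      intro s hs
      have hΨ : adelicMatrixFourier n K lam Φ ∈ schwartzBruhatAdelicMatrix n K :=
        adelicMatrixFourier_mem_schwartzBruhatAdelicMatrix lam hΦ
      have hw : ((n : ℂ) - s).re ≤ (n : ℝ) * n + n + 2 := by
        simp only [Complex.sub_re, Complex.natCast_re]
        nlinarith [hs, sq_nonneg (n : ℝ)]
      have hF1 : Integrable (gjTruncF n K Φ s : (AdelicGroupData.gl n K).Adelic → ℂ) ν := integrable_gjTruncF hΦ hs ν
      have hF2 : Integrable (fun g : (AdelicGroupData.gl n K).Adelic =>
          gjDualF n K (adelicMatrixFourier n K lam Φ) ((n : ℂ) - s) g⁻¹) ν :=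
        (integrable_gjDualF hΨ hw ν).comp_inv
      set L : ℂ := ((lam (matrixFundamentalDomain n K)).toReal : ℂ)⁻¹ with hL
      set T : (AdelicGroupData.gl n K).L2 μ →L[ℂ] (AdelicGroupData.gl n K).L2 μ :=
        gjZetaOp μ ν hF1 - L • gjZetaOp μ ν hF2 with hT
      have key : ∀ ψ ψ' : (AdelicGroupData.gl n K).L2 μ, ⟪ψ', T ψ⟫_ℂ =
          gjZeta μ (ν.restrict (detAtLeastOne n K)ᶜ) Φ ψ ψ' s -
            L * ∫ g : GL (Fin n) (AdeleRing (𝓞 K) K),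
              gjDualF n K (adelicMatrixFourier n K lam Φ) ((n : ℂ) - s) g⁻¹ * glMatrixCoeff μ ψ ψ' g ∂ν := by
        intro ψ ψ'
        show ⟪ψ', gjZetaOp μ ν hF1 ψ - L • gjZetaOp μ ν hF2 ψ⟫_ℂ = _
        have e : ∫ g : (AdelicGroupData.gl n K).Adelic, gjTruncF n K Φ s g * glMatrixCoeff μ ψ ψ' g ∂ν =
            gjZeta μ (ν.restrict (detAtLeastOne n K)ᶜ) Φ ψ ψ' s :=
          integral_gjTruncF_mul_glMatrixCoeff μ Φ ψ ψ' s ν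
        rw [inner_sub_right, inner_smul_right, inner_gjZetaOp, inner_gjZetaOp, e]
        rfl
      have hT0 : ∀ ψ ∈ smoothedCuspForms n K μ, ∀ ψ' ∈ smoothedCuspForms n K μ, ⟪ψ', T ψ⟫_ℂ = 0 := by
        intro ψ hψ ψ' _
        rw [key, gjZeta_restrict_compl_eq_dual_of_smoothedCuspForms hn μ ν lam hΦ hψ ψ' hs, sub_self]
      have h0 := inner_apply_eq_zero_of_smoothedCuspForms μ T hT0 (P.2.1 hφ) (P.2.1 hφ')
      rw [key] at h0
      exact sub_eq_zero.1 h0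
    obtain ⟨x₀, hint, g, hg, hgZ⟩ := gjZeta_entire_continuation_of_eq_dual μ hΦ φ φ' ν lam hvan
    exact ⟨x₀, hint, g, fun z => (hg.analyticAt z).meromorphicAt, fun _ => hg, hgZ⟩

end MeromorphicHolds


end Literature.NumberTheory.Automorphic
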